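import Summits.BirchSwinnertonDyer.BirchSwinnertonDyer.Theorems.AlignedTransportAtTwoMainConjectureOfRankZeroBSDAtTwoSeedTwoTorsionDescent
import Summits.BirchSwinnertonDyer.BirchSwinnertonDyer.Theorems.AlignedTransportAtTwoMainConjectureOfRankZeroBSDAtTwoFineRoadLocalArch
import HarnessLib

/-!
# Route `AlignedTransportAtTwo`, crux C2 `MainConjectureOfRankZeroBSDAtTwo` (stmt-BirchSwinnertonDyer-22298), line `birth`:
# perfect descent of the ordinary `E[2]`-structure WITH THE ARCHIMEDEAN CONDITION (both signs of `Δ_W`) — stub T at `(W, κ)` from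
# the finiteness of the invariant part of Greenberg–Vatsal's `S^{Σ₀}_{E[2]}` over `ℚ_∞(E[2])` CUT by the strict condition at the
# real places (PART XVIII of the att-p3 dictionary; repairs the `Δ_W > 0` gap of PART XVII)

HONEST FRAMING (cell `bsd-f1-sign2`, WIDTH-5 attach seat `bsd-line-att-p3` g7; `--supports stmt-BirchSwinnertonDyer-22298 --as helper`;
BSD is NOT proved by any of this; the crux C2 stays OPEN — «blocked-on `Rank1Residual.GreenbergMuConjectureIrreducible`»). THEOREMS ONLY —
no definition, no named fact, no `sorry`; C2-NEUTRAL; imports NO route file.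

WHY. PART XVII (`…SeedTwoTorsionDescent`) derives T at `(W, κ)` from the finiteness of (the invariant part over `ℚ_∞(E[2])` of)
Greenberg–Vatsal's `S^{Σ₀}_{E[2]}`, a structure with NO archimedean slot. For `Δ_W > 0` that hypothesis is never satisfied: over the totally
real `ℚ_∞`, `H¹(ℝ, E[2^∞]) = ℤ/2` at each of the `2ⁿ` real places of layer `n` and the `∞`-free structure contains the relaxed-at-`∞` Selmer
group, whose dual has `μ ≥ 1` (Greenberg LNM 1716 Lemma 4.6 at `2`). The repair is to CUT by the strict archimedean condition — Greenberg's
`infKer` («locally trivial at every real place»), which at `p = 2` IS the classical Kummer condition of `Sel_{2^∞}` for EVERY `E/ℚ` (att-p4 g3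
`LocalArch.localKerOver_two_eq_infKer`) — transported to `E[2]`-coefficients THROUGH `α = ι_*` (i.e. «`ι_*` of the class is locally trivial at
`∞`», not «the `E[2]`-class is locally trivial at `∞`»: `H¹(ℝ, E[2]) = E[2]` while `H¹(ℝ, E[2^∞]) = ℤ/2` for `Δ_W > 0`, cf. att-p5
RELAXED-COEFFICIENTS §3). Over `F_∞ = ℚ_∞(E[2])` the extra clause reads: at every real place `w` of `F_∞` (complex conjugation `c_w`, acting
trivially on `E[2]`), the value `φ(c_w) ∈ E[2]` of the homomorphism `φ` dies in `H¹(⟨c_w⟩, E[2^∞])`, i.e. lies on the identity-component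
line; for `Δ_W < 0` the clause is EMPTY (`LocalArch.infKer_eq_top_of_Δ_neg`) and this file reduces to PART XVII.

## What is proved

§1 (generic: number field `K`, discrete `Γ_K`-module `M`, `n`, normal `H₁ ≤ H₂`): `torsionToH1_resOfLe` (naturality `α ∘ res = res ∘ α`),
`resOfLe_mem_infKer` (restriction preserves the archimedean condition), `resOfLe_mem_archViaAlpha` (… and its `α`-transported `E[n]`-form).

§2 (`K = ℚ`, `p = 2`, `W` globally minimal with `2 ∤ Δ_W`, `κ` ANY `ℤ₂`-extension, `Σ₀ ⊇` odd bad primes, Greenberg's reduction datum):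
* `selmerInfty_le_gvSelmer_inf_arch`: `Sel_{2^∞}(W/ℚ_∞) ⊆ S^{Σ₀}_{E[2^∞]}(ℚ_∞) ⊓ ⨅_{w ∣ ∞, σ} conj_σ⁻¹ infKer_w` (tree link + `localKerOver_two_eq_infKer`);
* `finite_selmer_twoTorsion_of_finite_gvSelmerArch_twoTorsion`: if `{y ∈ S^{Σ₀}_{E[2]}(ℚ_∞) | α y strict at ∞}` is finite then
  `Sel_{2^∞}(W/ℚ_∞)[2]` is finite (GV Prop. 2.8 `α(S^{Σ₀}_{E[2]}) = S^{Σ₀}_{E[2^∞]} ⊓ H¹[2]`);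
* **`finite_selmer_twoTorsion_of_finite_invariants_divisionTower_arch`** and **`isTorsion_and_mu_eq_zero_of_finite_invariants_divisionTower_arch`**:
  IF the `Gal(ℚ̄/ℚ_∞)`-invariant classes `x` of `S^{Σ₀}_{E[2]}(ℚ_∞(E[2]))` with `α x` strict at every real place form a FINITE set, THEN
  `Sel_{2^∞}(W/ℚ_∞)[2]` is finite, hence (PART XVI) `X(W/ℚ_∞)` is `Λ`-torsion with `μ₂ = 0` for every dual datum — stub T at `(W, κ)`,
  BOTH SIGNS of `Δ_W`, print-free;
* `setOf_invariants_arch_eq_of_Δ_neg`: for `Δ_W < 0` the archimedean clause is automatic (the set equals PART XVII's).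

NOT claimed: the converse (PRINT `Sel = S` at `2` up to `μ`-neutral terms; exact descent with its finite `2`-adic defect), CFT naming.
References: R. Greenberg, V. Vatsal, Invent. Math. 142 (2000) §2 Prop. 2.8; R. Greenberg, LNM 1716 §2 (2) p. 72, §4 Lemma 4.6 p. 106;
K. Matsuno, J. Number Theory 128 (2008) Lemma 2.5; J.-P. Serre, *Galois Cohomology* I §2.6.
-/

set_option linter.dupNamespace false
set_option autoImplicit false

noncomputable section

open scoped Classical AddSubgroup

namespace Summit.BirchSwinnertonDyer.BirchSwinnertonDyer.Theorems.AlignedTransportAtTwoSeedTwoTorsion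

open NumberField IsDedekindDomain Field WeierstrassCurve
open Literature.NumberTheory.EllipticCurves Literature.NumberTheory.EllipticCurves.GreenbergSelmer
  Literature.NumberTheory.GaloisRepresentations
  Summit.BirchSwinnertonDyer.Rank1Residual.X2.TorsionComparison
  Summit.BirchSwinnertonDyer.Rank1Residual.X2.GreenbergVatsalTorsion
  Summit.BirchSwinnertonDyer.BirchSwinnertonDyer.Theorems.AlignedTransportAtTwoFineRoad

universe u

/-! ## §1 Naturality of `α = ι_*` and the archimedean condition along a restriction -/

section Generic

variable {K : Type u} [Field K] [NumberField K]
variable {M : Type u} [AddCommGroup M] [DistribMulAction (absoluteGaloisGroup K) M]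
  [TopologicalSpace M] [DiscreteTopology M]

omit [NumberField K] in
/-- **`α ∘ res = res ∘ α`**: the coefficient map `α = ι_* : H¹(·, M[n]) → H¹(·, M)` commutes with restriction along `H₁ ≤ H₂`
(both composites are induced by the pair `(H₁ ↪ H₂, M[n] ↪ M)`). [cite: SerreGaloisCohomology1997, I §2.4 (compatible pairs)] -/
theorem torsionToH1_resOfLe {H₁ H₂ : Subgroup (absoluteGaloisGroup K)} (h : H₁ ≤ H₂) (n : ℕ) (y : subgroupH1 H₂ ↥(M[(n : ℤ)])) :
    torsionToH1 H₁ M n (resOfLe (↥(M[(n : ℤ)])) h y) = resOfLe M h (torsionToH1 H₂ M n y) := by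
  rw [torsionToH1, torsionToH1, Literature.NumberTheory.EllipticCurves.resOfLe, Literature.NumberTheory.EllipticCurves.resOfLe,
    resH1Hom_resH1Hom, resH1Hom_resH1Hom]
  exact congrFun (congrArg DFunLike.coe (resH1Hom_congr (by ext; rfl) (by ext; rfl) _ _)) y

omit [NumberField K] in
/-- **Restriction preserves the archimedean condition**: if `c ∈ H¹(H₂, M)` dies on `H₂ ⊓ D_w` (`w` an infinite place) then `res c`
dies on `H₁ ⊓ D_w`. [cite: Greenberg1989, §1 p. 98 (3)] [cite: SerreGaloisCohomology1997, I §2.4] -/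
theorem resOfLe_mem_infKer {H₁ H₂ : Subgroup (absoluteGaloisGroup K)} (h : H₁ ≤ H₂) (w : InfinitePlace K)
    {c : subgroupH1 H₂ M} (hc : c ∈ infKer H₂ M w) : resOfLe M h c ∈ infKer H₁ M w := by
  rw [infKer, AddMonoidHom.mem_ker] at hc ⊢
  -- `res_{H₁ ⊓ D} ∘ res_{H₁ ≤ H₂} = res_{H₁ ⊓ D ≤ H₂ ⊓ D} ∘ res_{H₂ ⊓ D}` (both are `res_{H₁ ⊓ D ≤ H₂}`; att-p5's bookkeeping)
  have e1 := congrArg (fun f : subgroupH1 H₂ M →+ subgroupH1 (H₁ ⊓ decompInf w) M ↦ f c)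
    (resOfLe_comp_holds (M := M) (inf_le_left : H₁ ⊓ decompInf w ≤ H₁) h)
  have e2 := congrArg (fun f : subgroupH1 H₂ M →+ subgroupH1 (H₁ ⊓ decompInf w) M ↦ f c)
    (resOfLe_comp_holds (M := M) (inf_le_inf_right (decompInf w) h : H₁ ⊓ decompInf w ≤ H₂ ⊓ decompInf w)
      (inf_le_left : H₂ ⊓ decompInf w ≤ H₂))
  simp only [AddMonoidHom.comp_apply] at e1 e2
  rw [e1, ← e2, hc, map_zero]

omit [NumberField K] in
/-- **Restriction preserves the `α`-transported archimedean condition** on `E[n]`-classes: if `conj_σ (α y)` dies on `H₂ ⊓ D_w` for all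
`σ`, then `conj_σ (α (res y))` dies on `H₁ ⊓ D_w` for all `σ` (naturality of `α`, `res ∘ conj = conj ∘ res`, and `resOfLe_mem_infKer`).
[cite: SerreGaloisCohomology1997, I §2.5] -/
theorem resOfLe_mem_archViaAlpha {H₁ H₂ : Subgroup (absoluteGaloisGroup K)} [H₁.Normal] [H₂.Normal] (h : H₁ ≤ H₂) (n : ℕ)
    (w : InfinitePlace K) {y : subgroupH1 H₂ ↥(M[(n : ℤ)])}
    (hy : ∀ σ : absoluteGaloisGroup K, conjH1 H₂ M σ (torsionToH1 H₂ M n y) ∈ infKer H₂ M w) (σ : absoluteGaloisGroup K) :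
    conjH1 H₁ M σ (torsionToH1 H₁ M n (resOfLe (↥(M[(n : ℤ)])) h y)) ∈ infKer H₁ M w := by
  rw [torsionToH1_resOfLe]
  have e := congrArg (fun f : subgroupH1 H₂ M →+ subgroupH1 H₁ M ↦ f (torsionToH1 H₂ M n y))
    (resOfLe_comp_conjH1_holds (M := M) h σ)
  simp only [AddMonoidHom.comp_apply] at e
  rw [← e]
  exact resOfLe_mem_infKer h w (hy σ)

end Generic

/-! ## §2 `K = ℚ`, `p = 2`: the strict-at-`∞` cut, both signs of `Δ_W` -/

section Rat

open Summit.BirchSwinnertonDyer.Rank1Residual.X2.GreenbergVatsalReductionDatum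
  Summit.BirchSwinnertonDyer.Rank1Residual.X2.GreenbergVatsalTorsionCurve

variable (W : WeierstrassCurve ℚ) [W.IsElliptic] [W.IsGloballyMinimal] (κ : ZpExtension ℚ 2)
  (S₀ : Set (HeightOneSpectrum (𝓞 ℚ)))

/-- **`Sel_{2^∞}(W/ℚ_∞) ⊆ S^{Σ₀}_{E[2^∞]}(ℚ_∞) ⊓ (strict at every real place)`**: the finite-place half is the tree's link for Greenberg's
reduction datum (`selmerInfty_le_gvSelmerInfty_reductionData`); at the infinite place the classical Kummer condition IS Greenberg's `infKer`
at `p = 2` for every `E/ℚ` (att-p4 g3 `LocalArch.localKerOver_two_eq_infKer`: `E(ℝ) ⊗ ℚ₂/ℤ₂ = 0`).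
[cite: GreenbergVatsal2000, §2 p. 19 (6)] [cite: GreenbergLNM1716, §2 (2) p. 72 and §4 p. 106] -/
theorem selmerInfty_le_gvSelmer_inf_arch (hΔ : ¬ (2 : ℤ) ∣ minimalDiscriminantInt W)
    (hS : ∀ v : HeightOneSpectrum (𝓞 ℚ), v ∉ S₀ → ((2 : ℕ) : 𝓞 ℚ) ∉ v.asIdeal → W.HasGoodReductionAt v) :
    W.selmerInfty κ ≤ gvSelmer κ.kerSubgroup (W.geomPrimaryTorsion 2) 2 (reductionData W 2 hΔ) S₀ ⊓
      ⨅ (w : InfinitePlace ℚ) (σ : absoluteGaloisGroup ℚ),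
        (infKer κ.kerSubgroup (W.geomPrimaryTorsion 2) w).comap (conjH1 κ.kerSubgroup (W.geomPrimaryTorsion 2) σ) := by
  intro c hc
  refine AddSubgroup.mem_inf.2 ⟨selmerInfty_le_gvSelmerInfty_reductionData W 2 S₀ κ hΔ hS hc, ?_⟩
  simp only [AddSubgroup.mem_iInf, AddSubgroup.mem_comap]
  intro w σ
  have h := ((W.mem_selmerGroupOver_iff 2 κ.kerSubgroup c).1 hc).2 w σ
  rw [LocalArch.localKerOver_two_eq_infKer W κ.kerSubgroup w] at h
  exact h

/-- **If `{y ∈ S^{Σ₀}_{E[2]}(ℚ_∞) | conj_σ (α y) strict at ∞ for all σ, w}` is finite, then `Sel_{2^∞}(W/ℚ_∞)[2]` is finite** —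
`W/ℚ` globally minimal with `2 ∤ Δ_W`, ANY `ℤ₂`-extension `κ`, `Σ₀ ⊇` odd bad primes, BOTH signs of `Δ_W`: a `2`-torsion Selmer class is
`α y` for some `y ∈ S^{Σ₀}_{E[2]}(ℚ_∞)` (GV Prop. 2.8, tree `map_gvSelmer_torsion_eq`) and `α y = s` is strict at `∞` (previous lemma).
[cite: GreenbergVatsal2000, §2 Prop. (2.8)] [cite: GreenbergLNM1716, §4 Lemma 4.6 (p. 106)] -/
theorem finite_selmer_twoTorsion_of_finite_gvSelmerArch_twoTorsion (hΔ : ¬ (2 : ℤ) ∣ minimalDiscriminantInt W)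
    (hS : ∀ v : HeightOneSpectrum (𝓞 ℚ), v ∉ S₀ → ((2 : ℕ) : 𝓞 ℚ) ∉ v.asIdeal → W.HasGoodReductionAt v)
    (hfin : Set.Finite {y : subgroupH1 κ.kerSubgroup ↥((W.geomPrimaryTorsion 2)[((2 : ℕ) : ℤ)]) |
      y ∈ gvSelmer κ.kerSubgroup (↥((W.geomPrimaryTorsion 2)[((2 : ℕ) : ℤ)])) 2 (torsionData (reductionData W 2 hΔ) 2) S₀ ∧
        ∀ (w : InfinitePlace ℚ) (σ : absoluteGaloisGroup ℚ),
          conjH1 κ.kerSubgroup ↥(W.geomPrimaryTorsion 2) σ (torsionToH1 ↥κ.kerSubgroup ↥(W.geomPrimaryTorsion 2) 2 y) ∈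
            infKer κ.kerSubgroup (W.geomPrimaryTorsion 2) w}) :
    Set.Finite {s : W.selmerInfty κ | 2 • s = 0} := by
  set M := W.geomPrimaryTorsion 2 with hM
  have himg := map_gvSelmer_torsion_eq κ.kerSubgroup (W.geomPrimaryTorsion 2) 2 (reductionData W 2 hΔ) S₀ 2
    (continuous_smul_curve W 2) (divisible_curve W 2) (unramified_outside W 2 S₀ hS) (reductionData_htriv W 2 hΔ)
  have hle := selmerInfty_le_gvSelmer_inf_arch W κ S₀ hΔ hS
  -- `Sel[2]` (as a subset of `H¹(ℚ_∞, E[2^∞])`) lies in the image of the finite set under `α`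
  have hsub : ((fun s : W.selmerInfty κ ↦ (s : W.subgroupH1 2 κ.kerSubgroup)) '' {s | 2 • s = 0}) ⊆
      torsionToH1 κ.kerSubgroup (W.geomPrimaryTorsion 2) 2 '' {y |
        y ∈ gvSelmer κ.kerSubgroup (↥((W.geomPrimaryTorsion 2)[((2 : ℕ) : ℤ)])) 2 (torsionData (reductionData W 2 hΔ) 2) S₀ ∧
          ∀ (w : InfinitePlace ℚ) (σ : absoluteGaloisGroup ℚ),
            conjH1 κ.kerSubgroup ↥(W.geomPrimaryTorsion 2) σ (torsionToH1 ↥κ.kerSubgroup ↥(W.geomPrimaryTorsion 2) 2 y) ∈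
              infKer κ.kerSubgroup (W.geomPrimaryTorsion 2) w} := by
    rintro _ ⟨s, hs, rfl⟩
    have h2 : (s : W.subgroupH1 2 κ.kerSubgroup) ∈ (subgroupH1 κ.kerSubgroup (W.geomPrimaryTorsion 2))[((2 : ℕ) : ℤ)] := by
      rw [AddSubgroup.torsionBy.nsmul_iff]
      have := congrArg (fun z : W.selmerInfty κ ↦ (z : W.subgroupH1 2 κ.kerSubgroup)) hs
      simpa only [AddSubmonoidClass.coe_nsmul, ZeroMemClass.coe_zero] using this
    obtain ⟨hgv, harch⟩ := AddSubgroup.mem_inf.1 (hle s.2)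
    have hmem : (s : W.subgroupH1 2 κ.kerSubgroup) ∈
        (gvSelmer κ.kerSubgroup (↥((W.geomPrimaryTorsion 2)[((2 : ℕ) : ℤ)])) 2 (torsionData (reductionData W 2 hΔ) 2) S₀).map
          (torsionToH1 κ.kerSubgroup (W.geomPrimaryTorsion 2) 2) := by
      rw [himg]
      exact AddSubgroup.mem_inf.2 ⟨hgv, h2⟩
    obtain ⟨y, hy, hys⟩ := AddSubgroup.mem_map.1 hmem
    refine ⟨y, ⟨hy, fun w σ ↦ ?_⟩, hys⟩
    rw [hys]
    simp only [AddSubgroup.mem_iInf, AddSubgroup.mem_comap] at harch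
    exact harch w σ
  exact Set.Finite.of_finite_image ((hfin.image _).subset hsub) Subtype.coe_injective.injOn

/-- **T at `(W, κ)` from the sextic tower, BOTH SIGNS of `Δ_W` — finiteness form.** `W/ℚ` globally minimal with `2 ∤ Δ_W`, `κ` any
`ℤ₂`-extension, `Σ₀ ⊇` odd bad primes. IF the `Gal(ℚ̄/ℚ_∞)`-INVARIANT classes `x` of Greenberg–Vatsal's ordinary `E[2]`-structure over
`F_∞ = ℚ_∞(E[2])` whose `α x` is STRICT at every real place (continuous homomorphisms `φ : Gal(ℚ̄/F_∞) → E[2]` unramified at `w ∤ 2Σ₀`,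
`φ(I_w) ⊆ Ê[2]` at `w ∣ 2`, and `φ(c_w)` dying in `H¹(⟨c_w⟩, E[2^∞])` at every real `w` — empty for `Δ_W < 0`) form a FINITE set, THEN
`Sel_{2^∞}(W/ℚ_∞)[2]` is finite: restriction lands in that set (§1 + PART XVII §1) and is injective (PART XVII §2).
[cite: GreenbergVatsal2000, §2 Prop. (2.8)] [cite: GreenbergLNM1716, §4 Lemma 4.6 (p. 106)] [cite: SerreGaloisCohomology1997, I §2.6] -/
theorem finite_selmer_twoTorsion_of_finite_invariants_divisionTower_arch (hΔ : ¬ (2 : ℤ) ∣ minimalDiscriminantInt W)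
    (hS : ∀ v : HeightOneSpectrum (𝓞 ℚ), v ∉ S₀ → ((2 : ℕ) : 𝓞 ℚ) ∉ v.asIdeal → W.HasGoodReductionAt v)
    (hfin : Set.Finite {x : subgroupH1 (κ.kerSubgroup ⊓ (W.galoisRepTorsion 2).ker) ↥((W.geomPrimaryTorsion 2)[((2 : ℕ) : ℤ)]) |
      x ∈ gvSelmer (κ.kerSubgroup ⊓ (W.galoisRepTorsion 2).ker) (↥((W.geomPrimaryTorsion 2)[((2 : ℕ) : ℤ)])) 2
          (torsionData (reductionData W 2 hΔ) 2) S₀ ∧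
        (∀ (w : InfinitePlace ℚ) (σ : absoluteGaloisGroup ℚ),
          conjH1 (κ.kerSubgroup ⊓ (W.galoisRepTorsion 2).ker) ↥(W.geomPrimaryTorsion 2) σ
              (torsionToH1 ↥(κ.kerSubgroup ⊓ (W.galoisRepTorsion 2).ker) ↥(W.geomPrimaryTorsion 2) 2 x) ∈
            infKer (κ.kerSubgroup ⊓ (W.galoisRepTorsion 2).ker) (W.geomPrimaryTorsion 2) w) ∧
        ∀ g ∈ κ.kerSubgroup,
          conjH1 (κ.kerSubgroup ⊓ (W.galoisRepTorsion 2).ker) (↥((W.geomPrimaryTorsion 2)[((2 : ℕ) : ℤ)])) g x = x}) :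
    Set.Finite {s : W.selmerInfty κ | 2 • s = 0} := by
  refine finite_selmer_twoTorsion_of_finite_gvSelmerArch_twoTorsion W κ S₀ hΔ hS ?_
  have hinj := resOfLe_torsionBy_two_injective W κ.kerSubgroup
  refine Set.Finite.of_finite_image (hfin.subset ?_) hinj.injOn
  rintro _ ⟨y, ⟨hy, harch⟩, rfl⟩
  exact ⟨resOfLe_mem_gvSelmer 2 (torsionData (reductionData W 2 hΔ) 2) S₀ inf_le_left hy,
    fun w σ ↦ resOfLe_mem_archViaAlpha inf_le_left 2 w (harch w) σ,
    fun g hg ↦ conjH1_resOfLe_of_mem (M := ↥((W.geomPrimaryTorsion 2)[((2 : ℕ) : ℤ)])) inf_le_left hg y⟩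

/-- **THE REGISTERED STUB T OF LINE `birth` AT `(W, κ)` FROM THE SEXTIC TOWER, BOTH SIGNS OF `Δ_W`** (the lead's O1, sufficiency half,
print-free, with the archimedean clause): `W/ℚ` globally minimal with `2 ∤ Δ_W`, ANY `ℤ₂`-extension `κ` with a topological generator,
`Σ₀ ⊇` odd bad primes — if the invariant, strict-at-`∞` classes of `S^{Σ₀}_{E[2]}(ℚ_∞(E[2]))` form a finite set, then for EVERY topological
generator `γ` and EVERY dual datum `D`, `X(W/ℚ_∞)` is `Λ`-torsion with `μ₂ = 0` (PART XVI `finite_pTorsion_iff_forall`).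
[cite: GreenbergLNM1716, §1 Conj. 1.11 and §4 Lemma 4.6] [cite: GreenbergVatsal2000, §2 Prop. (2.8)] -/
theorem isTorsion_and_mu_eq_zero_of_finite_invariants_divisionTower_arch (hΔ : ¬ (2 : ℤ) ∣ minimalDiscriminantInt W)
    (hS : ∀ v : HeightOneSpectrum (𝓞 ℚ), v ∉ S₀ → ((2 : ℕ) : 𝓞 ℚ) ∉ v.asIdeal → W.HasGoodReductionAt v)
    {γ₀ : absoluteGaloisGroup ℚ} (hγ₀ : κ.IsTopGenerator γ₀)
    (hfin : Set.Finite {x : subgroupH1 (κ.kerSubgroup ⊓ (W.galoisRepTorsion 2).ker) ↥((W.geomPrimaryTorsion 2)[((2 : ℕ) : ℤ)]) |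
      x ∈ gvSelmer (κ.kerSubgroup ⊓ (W.galoisRepTorsion 2).ker) (↥((W.geomPrimaryTorsion 2)[((2 : ℕ) : ℤ)])) 2
          (torsionData (reductionData W 2 hΔ) 2) S₀ ∧
        (∀ (w : InfinitePlace ℚ) (σ : absoluteGaloisGroup ℚ),
          conjH1 (κ.kerSubgroup ⊓ (W.galoisRepTorsion 2).ker) ↥(W.geomPrimaryTorsion 2) σ
              (torsionToH1 ↥(κ.kerSubgroup ⊓ (W.galoisRepTorsion 2).ker) ↥(W.geomPrimaryTorsion 2) 2 x) ∈
            infKer (κ.kerSubgroup ⊓ (W.galoisRepTorsion 2).ker) (W.geomPrimaryTorsion 2) w) ∧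
        ∀ g ∈ κ.kerSubgroup,
          conjH1 (κ.kerSubgroup ⊓ (W.galoisRepTorsion 2).ker) (↥((W.geomPrimaryTorsion 2)[((2 : ℕ) : ℤ)])) g x = x}) :
    ∀ (γ : absoluteGaloisGroup ℚ), κ.IsTopGenerator γ → ∀ D : W.SelmerDualData κ γ, D.IsTorsion ∧ D.mu = 0 :=
  (finite_pTorsion_iff_forall W κ hγ₀).1
    (finite_selmer_twoTorsion_of_finite_invariants_divisionTower_arch W κ S₀ hΔ hS hfin)

/-- **For `Δ_W < 0` the archimedean clause is EMPTY**: every class over `ℚ_∞(E[2])` is strict at `∞` (`LocalArch.infKer_eq_top_of_Δ_neg`: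
complex conjugation moves a `2`-torsion point, `H¹(ℝ, E[2^∞]) = 0`), so the strict-at-`∞` invariant set is PART XVII's invariant set.
[cite: GreenbergLNM1716, §4 p. 106] -/
theorem setOf_invariants_arch_eq_of_Δ_neg (hΔneg : W.Δ < 0) (hΔ : ¬ (2 : ℤ) ∣ minimalDiscriminantInt W) :
    {x : subgroupH1 (κ.kerSubgroup ⊓ (W.galoisRepTorsion 2).ker) ↥((W.geomPrimaryTorsion 2)[((2 : ℕ) : ℤ)]) |
      x ∈ gvSelmer (κ.kerSubgroup ⊓ (W.galoisRepTorsion 2).ker) (↥((W.geomPrimaryTorsion 2)[((2 : ℕ) : ℤ)])) 2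
          (torsionData (reductionData W 2 hΔ) 2) S₀ ∧
        (∀ (w : InfinitePlace ℚ) (σ : absoluteGaloisGroup ℚ),
          conjH1 (κ.kerSubgroup ⊓ (W.galoisRepTorsion 2).ker) ↥(W.geomPrimaryTorsion 2) σ
              (torsionToH1 ↥(κ.kerSubgroup ⊓ (W.galoisRepTorsion 2).ker) ↥(W.geomPrimaryTorsion 2) 2 x) ∈
            infKer (κ.kerSubgroup ⊓ (W.galoisRepTorsion 2).ker) (W.geomPrimaryTorsion 2) w) ∧
        ∀ g ∈ κ.kerSubgroup,
          conjH1 (κ.kerSubgroup ⊓ (W.galoisRepTorsion 2).ker) (↥((W.geomPrimaryTorsion 2)[((2 : ℕ) : ℤ)])) g x = x} =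
    {x : subgroupH1 (κ.kerSubgroup ⊓ (W.galoisRepTorsion 2).ker) ↥((W.geomPrimaryTorsion 2)[((2 : ℕ) : ℤ)]) |
      x ∈ gvSelmer (κ.kerSubgroup ⊓ (W.galoisRepTorsion 2).ker) (↥((W.geomPrimaryTorsion 2)[((2 : ℕ) : ℤ)])) 2
          (torsionData (reductionData W 2 hΔ) 2) S₀ ∧
        ∀ g ∈ κ.kerSubgroup,
          conjH1 (κ.kerSubgroup ⊓ (W.galoisRepTorsion 2).ker) (↥((W.geomPrimaryTorsion 2)[((2 : ℕ) : ℤ)])) g x = x} := by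
  ext x
  simp only [Set.mem_setOf_eq]
  constructor
  · rintro ⟨h1, -, h3⟩
    exact ⟨h1, h3⟩
  · rintro ⟨h1, h3⟩
    refine ⟨h1, fun w σ ↦ ?_, h3⟩
    rw [LocalArch.infKer_eq_top_of_Δ_neg W hΔneg]
    exact AddSubgroup.mem_top _

end Rat

end Summit.BirchSwinnertonDyer.BirchSwinnertonDyer.Theorems.AlignedTransportAtTwoSeedTwoTorsion

end
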